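import Summits.KontsevichZagierPeriods.KontsevichZagierPeriods.Theses.HyperbolicBloch
import Summits.KontsevichZagierPeriods.KontsevichZagierPeriods.Theorems.TerasomaMultiplicationBetaCancellationOfAyoubPiCancellation
import Literature.NumberTheory.Transcendental.KZKernelConjectureForms

/-!
# `OffTetraSectorKernel` (stmt-KontsevichZagierPeriods-10557) split along `[π]`: the glue, its
# exactness modulo the sector, and the position of the two children under the summit

Crux `HyperbolicBloch.OffTetraSectorKernel` (route HyperbolicBloch, item 10557) is the kernel form of
Kontsevich–Zagier's Conjecture 1 with the `ℚ̄`-ideal-tetrahedron value-relators adjoined; it is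
implied by the kernel form and gives it back modulo the route's PROVED sector `TetraSector` fed with
`ZagierDilogarithmConjecture` (the route's deciding theorem `closes`), so it is summit-strength and no
re-cut "proved sectors ⊔ remainder" lowers it (crux-strategist census, `Cruxes/OffTetraSectorKernel/
STRATEGY-CENSUS.md`). The one typed decomposition of it into pieces that are each STRICTLY WEAKER than
the summit — in the tree and in print — is Kontsevich–Zagier's own localisation `P̂ = P[(2πi)⁻¹]`
(*Periods*, 2001, §4.1) read in both directions, i.e. the split of route AyoubSpecialisation along the
disc `[π]` into the two EXISTING, vetted, shared items

* `Sub₁` = stmt-0541 `AyoubPiLocalKernel` (for every pinned family `P n r = [unit disc] × r`: every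
  formal combination of value `0` becomes a relation after finitely many applications of
  `lift (of ∘ P)`; = `KZ.PiLocalKernel`, Ayoub's Conjecture 7 for this calculus — the half reachable by
  torsor arguments, of period-conjecture DIFFICULTY but not known to imply Conjecture 1), and
* `Sub₂` = stmt-0540 `AyoubPiCancellation` (`lift (of ∘ P)` reflects relations; = `KZ.PiCancellation`,
  `[π]` is a non-zero-divisor of `FormalRep ⧸ relations` — transcendence-free, open even in its
  motivic shadow, Huber–Wüstholz 2022 App. A.4).

This file proves, sorry-free and against the two antecedents written out VERBATIM (the literal
statements of items 0541 and 0540, so that `route edit --split … --glue-by` matches them):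

* `offTetraSectorKernel_of_subs : Sub₁ → Sub₂ → OffTetraSectorKernel` — THE GLUE (peel the `[π]`
  factors one at a time; the pinned family exists, `BetaCancellationLine.exists_pinned`; then the
  kernel form lands in the left summand of `relations ⊔ closure tetra`);
* `subs_of_summit : KontsevichZagierPeriods → Sub₁ ∧ Sub₂` — each child is a CONSEQUENCE of the summit
  (`N = 0`; soundness `eval ([π]·c) = π · eval c`), so neither is the crux or the summit weakened for
  free, and a refutation of either refutes Conjecture 1;
* `offTetraSectorKernel_iff_subs_of_sector : TetraSector → ZagierDilogarithmConjecture →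
  (OffTetraSectorKernel ↔ Sub₁ ∧ Sub₂)` — EXACTNESS of the split modulo the route's sector (through the
  route's own deciding theorem `closes`): nothing is lost by the cut.

Neither child alone is known to imply the other, the crux, or the summit (tree: only the conditional
dictionary `LiouvilleUnfolding.PiLocalisation.ayoubPiCancellation_iff_summit_of_ayoubPiLocalKernel` /
`…ayoubPiLocalKernel_iff_summit_of_ayoubPiCancellation`; print: Ayoub 2014 Rem. 8, Huber–Wüstholz
2022 App. A.3–A.4). Nothing here asserts either child.

## References

* M. Kontsevich, D. Zagier, *Periods*, in: Mathematics Unlimited — 2001 and Beyond, Springer (2001),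
  §1.2 Conjecture 1; §4.1 (`P̂ = P[(2πi)⁻¹]`). [KontsevichZagier2001]
* J. Ayoub, *Periods and the conjectures of Grothendieck and Kontsevich–Zagier*, EMS Newsl. 91 (2014),
  Def. 6, Conj. 7, Rem. 8. [Ayoub2014]
* A. Huber, G. Wüstholz, *Transcendence and linear relations of 1-periods*, Cambridge Tracts 227
  (2022), App. A.3–A.4. [HuberWustholz2022]
* A. Huber, S. Müller-Stach, *Periods and Nori Motives*, Springer (2017), Def. 12.1.1, Conj. 13.2.1.
  [HuberMullerStachPeriods2017]
-/

noncomputable section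

namespace Summit.KontsevichZagierPeriods.HyperbolicBloch.OffTetraSectorKernel.PiSplit

open Literature.NumberTheory.Transcendental
open Summit.KontsevichZagierPeriods.KontsevichZagierPeriods.Theses.HyperbolicBloch
  (OffTetraSectorKernel TetraSector ZagierDilogarithmConjecture closes)
open Summit.KontsevichZagierPeriods.KontsevichZagierPeriods.Theses.AyoubSpecialisation
  (AyoubPiLocalKernel AyoubPiCancellation)

/-! ## The kernel form lands in the crux (left summand) -/

/-- **Kernel form ⇒ crux.** If every formal combination of value `0` is a relation, then a fortiori
it lies in `relations ⊔ closure (tetra relators)` for the standard family (indeed for any family).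
[cite: KontsevichZagier2001, §1.2 Conjecture 1] -/
theorem offTetraSectorKernel_of_kernel
    (h : ∀ c : KZ.FormalRep, KZ.eval c = 0 → c ∈ KZ.relations) : OffTetraSectorKernel :=
  fun _ _ c hc => AddSubgroup.mem_sup_left (h c hc)

/-! ## The glue: peel the `[π]` factors -/

/-- **Peeling at a pinned family.** If, for ONE pinned family `P`, every value-`0` combination has
`(lift (of ∘ P))^[N] c ∈ relations` for some `N` and `lift (of ∘ P)` reflects relations, then the
kernel form holds: induction on `N`, one factor at a time.
[cite: KontsevichZagier2001, §4.1] -/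
theorem kernel_of_local_of_cancel_at
    (P : ∀ n : ℕ, KZ.IntegralRep n → KZ.IntegralRep (n + 2))
    (hL : ∀ c : KZ.FormalRep, KZ.eval c = 0 → ∃ N : ℕ,
      (⇑(FreeAbelianGroup.lift (fun s : (Σ n, KZ.IntegralRep n) => KZ.of (P s.1 s.2))))^[N] c ∈
        KZ.relations)
    (hC : ∀ c : KZ.FormalRep,
      FreeAbelianGroup.lift (fun s : (Σ n, KZ.IntegralRep n) => KZ.of (P s.1 s.2)) c ∈ KZ.relations →
        c ∈ KZ.relations) :
    ∀ c : KZ.FormalRep, KZ.eval c = 0 → c ∈ KZ.relations := by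
  intro c hc
  obtain ⟨N, hN⟩ := hL c hc
  induction N with
  | zero => simpa using hN
  | succ N ih => exact ih (hC _ (by simpa only [Function.iterate_succ_apply'] using hN))

/-- **THE GLUE of the split of `OffTetraSectorKernel` along `[π]`** — `Sub₁ → Sub₂ → OffTetraSectorKernel`,
with `Sub₁` the literal statement of item stmt-0541 (`AyoubPiLocalKernel`) and `Sub₂` the literal
statement of item stmt-0540 (`AyoubPiCancellation`). Proof: the pinned family exists
(`BetaCancellationLine.exists_pinned`: `P n r := ([π] × r)` reindexed), peel at it
(`kernel_of_local_of_cancel_at`), land in the left summand (`offTetraSectorKernel_of_kernel`).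
[cite: KontsevichZagier2001, §4.1] [cite: Ayoub2014, Def. 6 and Conj. 7] -/
theorem offTetraSectorKernel_of_subs :
    (∀ (P : ∀ n : ℕ, Literature.NumberTheory.Transcendental.KZ.IntegralRep n → Literature.NumberTheory.Transcendental.KZ.IntegralRep (n + 2)), (∀ (n : ℕ) (r : Literature.NumberTheory.Transcendental.KZ.IntegralRep n), (P n r).domain = {z : Fin (n + 2) → ℝ | z 0 ^ 2 + z 1 ^ 2 ≤ 1 ∧ (fun i : Fin n => z i.succ.succ) ∈ r.domain} ∧ (P n r).integrand = fun z => r.integrand (fun i : Fin n => z i.succ.succ)) → ∀ c : Literature.NumberTheory.Transcendental.KZ.FormalRep, Literature.NumberTheory.Transcendental.KZ.eval c = 0 → ∃ N : ℕ, (⇑(FreeAbelianGroup.lift (fun s : (Σ n, Literature.NumberTheory.Transcendental.KZ.IntegralRep n) => Literature.NumberTheory.Transcendental.KZ.of (P s.1 s.2))))^[N] c ∈ Literature.NumberTheory.Transcendental.KZ.relations) →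
    (∀ (P : ∀ n : ℕ, Literature.NumberTheory.Transcendental.KZ.IntegralRep n → Literature.NumberTheory.Transcendental.KZ.IntegralRep (n + 2)), (∀ (n : ℕ) (r : Literature.NumberTheory.Transcendental.KZ.IntegralRep n), (P n r).domain = {z : Fin (n + 2) → ℝ | z 0 ^ 2 + z 1 ^ 2 ≤ 1 ∧ (fun i : Fin n => z i.succ.succ) ∈ r.domain} ∧ (P n r).integrand = fun z => r.integrand (fun i : Fin n => z i.succ.succ)) → ∀ c : Literature.NumberTheory.Transcendental.KZ.FormalRep, FreeAbelianGroup.lift (fun s : (Σ n, Literature.NumberTheory.Transcendental.KZ.IntegralRep n) => Literature.NumberTheory.Transcendental.KZ.of (P s.1 s.2)) c ∈ Literature.NumberTheory.Transcendental.KZ.relations → c ∈ Literature.NumberTheory.Transcendental.KZ.relations) →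
    OffTetraSectorKernel := by
  intro hL hC
  obtain ⟨P, hP⟩ :=
    Summit.KontsevichZagierPeriods.KontsevichZagierPeriods.BetaCancellationLine.exists_pinned
  exact offTetraSectorKernel_of_kernel (kernel_of_local_of_cancel_at P (hL P hP) (hC P hP))

/-- The glue, by the children's NAMES (items 0541, 0540 as decls of route AyoubSpecialisation; the
HyperbolicBloch copies have the same bodies). [cite: KontsevichZagier2001, §4.1] -/
theorem offTetraSectorKernel_of_ayoubPiLocalKernel_of_ayoubPiCancellation
    (hL : AyoubPiLocalKernel) (hC : AyoubPiCancellation) : OffTetraSectorKernel :=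
  offTetraSectorKernel_of_subs hL hC

/-! ## Position of the children: consequences of the summit -/

/-- **The kernel form implies both children** (`N = 0` for `Sub₁`; for `Sub₂`, `lift (of ∘ P) c` is
`[π] * c` modulo relations and `eval ([π] * c) = π · eval c` with `π ≠ 0`, soundness of the moves).
[cite: KontsevichZagier2001, §1.2 and §4.1] -/
theorem subs_of_kernel (hK : ∀ c : KZ.FormalRep, KZ.eval c = 0 → c ∈ KZ.relations) :
    AyoubPiLocalKernel ∧ AyoubPiCancellation := by
  refine ⟨fun P _ c hc => ⟨0, by simpa using hK c hc⟩, fun P hP c hc => hK c ?_⟩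
  have hπ : KZ.of KZ.piRep * c ∈ KZ.relations :=
    (Summit.KontsevichZagierPeriods.KontsevichZagierPeriods.BetaCancellationLine.lift_mem_relations_iff
      P hP c).1 hc
  exact KZ.eval_eq_zero_of_piRep_mul_mem_relations KZ.relations_le_ker_eval_holds hπ

/-- **The summit implies both children**: `KontsevichZagierPeriods → Sub₁ ∧ Sub₂` (through the tree's
`kzKernelConjecture_iff_isRational`, whose right-hand side is the summit body). So each child is a
consequence of Conjecture 1 — a refutation of either refutes the summit — and neither is the summit
renamed unless the OTHER child is a theorem. [cite: KontsevichZagier2001, §1.2 Conjecture 1] -/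
theorem subs_of_summit (h : _root_.KontsevichZagierPeriods) : AyoubPiLocalKernel ∧ AyoubPiCancellation :=
  subs_of_kernel (kzKernelConjecture_iff_isRational.mpr (KontsevichZagierPeriods_iff.mp h))

/-! ## Exactness of the split modulo the sector -/

/-- **Modulo the route's sector the split is exact**: given `TetraSector` (PROVED in the tree) and
`ZagierDilogarithmConjecture` (the route's named transcendence input), `OffTetraSectorKernel ↔ Sub₁ ∧
Sub₂`. `→`: the route's deciding theorem `closes` gives the summit, then `subs_of_summit`; `←`: the glue.
[cite: KontsevichZagier2001, §1.2 Conjecture 1 and §4.1] -/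
theorem offTetraSectorKernel_iff_subs_of_sector (hS : TetraSector) (hZ : ZagierDilogarithmConjecture) :
    OffTetraSectorKernel ↔ (AyoubPiLocalKernel ∧ AyoubPiCancellation) :=
  ⟨fun hO => subs_of_summit (closes hS hZ hO),
    fun h => offTetraSectorKernel_of_ayoubPiLocalKernel_of_ayoubPiCancellation h.1 h.2⟩

/-- Unconditionally: the children together decide the summit itself (via the crux only modulo the
sector, but directly through the kernel form). [cite: KontsevichZagier2001, §1.2 Conjecture 1] -/
theorem summit_of_subs (hL : AyoubPiLocalKernel) (hC : AyoubPiCancellation) :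
    _root_.KontsevichZagierPeriods := by
  obtain ⟨P, hP⟩ :=
    Summit.KontsevichZagierPeriods.KontsevichZagierPeriods.BetaCancellationLine.exists_pinned
  exact KontsevichZagierPeriods_iff.mpr
    (kzKernelConjecture_iff_isRational.mp (kernel_of_local_of_cancel_at P (hL P hP) (hC P hP)))

end Summit.KontsevichZagierPeriods.HyperbolicBloch.OffTetraSectorKernel.PiSplit

end
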